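import Summits.ResolutionOfSingularities.ResolutionOfSingularities.Theorems.FrobeniusLadderFInjectiveMacaulayficationClosedPointLocalResolutionAdm
import Literature.AlgebraicGeometry.Resolution.SmoothFibreChart
import Mathlib.RingTheory.NoetherNormalization
import HarnessLib

/-!
# THE LEVEL-`e` RUNG OVER TRANSCENDENTAL FIELDS: `ClosedPointLocalResolutionAdmTr p e r` — closed-point admissible local resolution of `e`-folds over
# `k(X₁,…,X_r)` — and (LR_adm) from the levels `4 ≤ e`, `r ≥ 1` ONLY (crux `FInjectiveMacaulayfication` stmt-ResolutionOfSingularities-15315, chain w45a;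
# res-L1-w45a-plan-1 CRUX-PLAN v31.1 §B/§D «the e = 4 level in isolation (closed-point admissible local resolution of 4-folds over a finitely generated
# IMPERFECT field K/k) as its own def»; seat res-L1-w45a-stub-3 g8)

[OURS · L1 W4.5a] Support file (`--supports stmt-ResolutionOfSingularities-15315 --as helper`); replaces the role of NO printed item; NOT a statement of any
manuscript; ONE definition (`@[conjecture] def`, OURS candidate, consumed only as a hypothesis; no instance, no notation, no named fact) and its consumers.
AI-written (AI review is weaker than expert review).

WHY (res-L1-w45a-plan-1, CRUX-PLAN v31.1 §B ruling): the rung `ClosedPointLocalResolutionAdm p e` (p598957) ranges over ALL fields of characteristic `p`, so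
it contains closed-point local resolution of `e`-folds over PERFECT fields — MORE than (LR_adm) needs: a NON-closed point `x` of a variety over `k` is a
closed point over `K = k(X₁,…,X_r)` with `r = trdeg_k κ(x) ≥ 1`, never over `k` itself. This file records `r ≥ 1`:

* §1 `exists_closedPoint_chart_ring_pos` — the ring lemma of `NonClosedPointChart` with the extra conclusion `𝔭.IsMaximal ∨ 0 < r` (if Noether
  normalisation of `A/𝔭` needs no variable, `A/𝔭` is integral over `k`, hence a field); `exists_closedPoint_model_pos` — the scheme lemma with the extra
  conclusion `IsClosed {x} ∨ 0 < r` (a maximal ideal of an affine open of a Jacobson scheme is a closed point,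
  `Literature.….isClosed_singleton_fromSpec_of_isMaximal`).
* §2 `ClosedPointLocalResolutionAdmTr p e r` — [OURS · CANDIDATE] the (LR_adm) body at CLOSED points of integral separated finite-type `e`-folds over the
  purely transcendental field `FractionRing (MvPolynomial (Fin r) k)` of an ARBITRARY field `k` of characteristic `p` (so `trdeg_k K = r` by construction;
  for `r ≥ 1` the ground field is NEVER perfect). `closedPointLocalResolutionAdmTr_of_adm` : the all-fields rung implies it.
* §3 PROVED: `localBody_at_nonClosed_of_tr` and ★ **`localResolutionNonClosedGe4Adm_of_tr :
  (∀ p e r, p.Prime → 4 ≤ e → 1 ≤ r → ClosedPointLocalResolutionAdmTr p e r) → RegularOffFiniteOfLRAdm.LocalResolutionNonClosedGe4Adm`** (only `r ≥ 1`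
  is consumed); per `d`-fold form `localBody_at_nonClosed_of_tr_lt` (levels `4 ≤ e ≤ d − 1`, `r ≥ 1`). The level singled out by the planner is
  `ClosedPointLocalResolutionAdmTr p 4 r`, `r ≥ 1`: closed-point admissible local resolution of 4-folds over `k(X₁,…,X_r)`.

[candidate statement, OURS; cite: Temkin2008, Prop. 2.3.4 (iii) and Def. 2.2.6; EGAIV2, §5–§6; Matsumura1987, §33 Lemma 2; GortzWedhorn2020, Thm. 5.22]
-/

-- single-problem summit: the doubled namespace component is forced
set_option linter.dupNamespace false

noncomputable section

namespace Summit.ResolutionOfSingularities.ResolutionOfSingularities.Theorems.FInjectiveMacaulayfication.ClosedPointLocalResolutionAdmTr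

open CategoryTheory AlgebraicGeometry TopologicalSpace IsLocalRing
open Literature.AlgebraicGeometry.Resolution
open Summit.ResolutionOfSingularities.ResolutionOfSingularities.Theorems.FInjectiveMacaulayfication

/-! ## §1 The chart lemmas with the transcendence count -/

/-- **`A_𝔭` is the local ring of a finite-type algebra over `k(X₁,…,X_r)` at a MAXIMAL ideal — with the transcendence count: `r = 0` only if `𝔭` is
maximal.** Same construction as `NonClosedPointChart.exists_closedPoint_chart_ring` (whose statement forgets this); the extra clause: if Noether
normalisation of `A/𝔭` (Mathlib `exists_integral_inj_algHom_of_fg`) has `r = 0` variables then `A/𝔭` is integral over `k`, hence a field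
(`isField_of_isIntegral_of_isField'`), hence `𝔭` is maximal. [folklore; cite: EGAIV2, §6; Matsumura1987, §33 Lemma 2 and Thm. 5.6] -/
theorem exists_closedPoint_chart_ring_pos (k : Type) [Field k] (A : Type) [CommRing A] [IsDomain A] [Algebra k A]
    [Algebra.FiniteType k A] (𝔭 : Ideal A) [𝔭.IsPrime] (L : Type) [CommRing L] [Algebra A L]
    [IsLocalization.AtPrime L 𝔭] :
    ∃ (r : ℕ) (B : Type) (_ : CommRing B) (_ : IsDomain B)
      (_ : Algebra (FractionRing (MvPolynomial (Fin r) k)) B)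
      (_ : Algebra.FiniteType (FractionRing (MvPolynomial (Fin r) k)) B)
      (𝔮 : Ideal B) (_ : 𝔮.IsMaximal) (_ : Algebra B L), IsLocalization.AtPrime L 𝔮 ∧ (𝔭.IsMaximal ∨ 0 < r) := by
  classical
  haveI : IsLocalRing L := IsLocalization.AtPrime.isLocalRing L 𝔭
  haveI : IsDomain L := IsLocalization.isDomain_of_atPrime L 𝔭
  -- Step 1: Noether normalisation of `D = A/𝔭`
  haveI : Nontrivial (A ⧸ 𝔭) := Ideal.Quotient.nontrivial_iff.mpr Ideal.IsPrime.ne_top'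
  obtain ⟨r, g, hginj, hgint⟩ := exists_integral_inj_algHom_of_fg k (A ⧸ 𝔭)
  -- `r = 0` forces `A/𝔭` to be integral over `k`, hence a field, hence `𝔭` maximal
  have h0r : 𝔭.IsMaximal ∨ 0 < r := by
    rcases Nat.eq_zero_or_pos r with hr | hr
    · left
      subst hr
      have hgC : ∀ P : MvPolynomial (Fin 0) k, g P = algebraMap k (A ⧸ 𝔭) (MvPolynomial.constantCoeff P) := by
        intro P
        conv_lhs => rw [MvPolynomial.eq_C_of_isEmpty P]
        exact g.commutes _
      haveI : Algebra.IsIntegral k (A ⧸ 𝔭) := by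
        refine ⟨fun x => ?_⟩
        obtain ⟨P, hPm, hP⟩ := hgint x
        refine ⟨P.map (MvPolynomial.constantCoeff : MvPolynomial (Fin 0) k →+* k), hPm.map _, ?_⟩
        rw [Polynomial.eval₂_map]
        have hcomp : (algebraMap k (A ⧸ 𝔭)).comp (MvPolynomial.constantCoeff : MvPolynomial (Fin 0) k →+* k) = g.toRingHom := by
          ext P
          · simp [hgC]
          · exact (IsEmpty.false (‹Fin 0›)).elim
        rw [hcomp]
        exact hP
      exact Ideal.Quotient.maximal_of_isField 𝔭
        (isField_of_isIntegral_of_isField' (R := k) (S := A ⧸ 𝔭) (Field.toIsField k))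
    · exact Or.inr hr
  -- Step 2: lift the normalising elements to `A`
  choose s hs using fun i : Fin r => Ideal.Quotient.mk_surjective (I := 𝔭) (g (MvPolynomial.X i))
  let φ : MvPolynomial (Fin r) k →ₐ[k] A := MvPolynomial.aeval s
  have hφg : ∀ P, Ideal.Quotient.mk 𝔭 (φ P) = g P := by
    intro P
    have h : (Ideal.Quotient.mkₐ k 𝔭).comp φ = g :=
      MvPolynomial.algHom_ext fun i => by simp [φ, hs]
    exact DFunLike.congr_fun h P
  have hφ𝔭 : ∀ P : MvPolynomial (Fin r) k, P ≠ 0 → φ P ∈ 𝔭.primeCompl := by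
    intro P hP h
    refine hP (hginj ?_)
    rw [← hφg, Ideal.Quotient.eq_zero_iff_mem.mpr h, map_zero]
  -- Step 3: `K = k(X₁,…,X_r) → L`
  have hunit : ∀ y : nonZeroDivisors (MvPolynomial (Fin r) k),
      IsUnit (((algebraMap A L).comp φ.toRingHom) y) := fun y =>
    IsLocalization.map_units L ⟨φ y, hφ𝔭 y (nonZeroDivisors.ne_zero y.2)⟩
  let ψK : FractionRing (MvPolynomial (Fin r) k) →+* L := IsLocalization.lift hunit
  have hψK : ∀ P, ψK (algebraMap _ (FractionRing (MvPolynomial (Fin r) k)) P) = algebraMap A L (φ P) :=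
    fun P => IsLocalization.lift_eq hunit P
  letI : Algebra (FractionRing (MvPolynomial (Fin r) k)) L := ψK.toAlgebra
  -- Step 4: `B := K[A] ⊆ L`
  let θ : A →+* L := algebraMap A L
  let B : Subalgebra (FractionRing (MvPolynomial (Fin r) k)) L :=
    Algebra.adjoin (FractionRing (MvPolynomial (Fin r) k)) (Set.range θ)
  -- finite type: `A = k[t]` for a finite `t`, and `B = K[θ t]`
  obtain ⟨t, ht⟩ := Algebra.FiniteType.out (R := k) (A := A)
  have hBt : B = Algebra.adjoin (FractionRing (MvPolynomial (Fin r) k)) (θ '' (t : Set A)) := by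
    apply le_antisymm
    · refine Algebra.adjoin_le ?_
      rintro _ ⟨a, rfl⟩
      have ha : a ∈ Algebra.adjoin k (t : Set A) := by rw [ht]; trivial
      refine Algebra.adjoin_induction (hx := ha) ?_ ?_ ?_ ?_
      · exact fun x hx => Algebra.subset_adjoin ⟨x, hx, rfl⟩
      · intro c
        have hc : θ (algebraMap k A c) =
            ψK (algebraMap (MvPolynomial (Fin r) k) (FractionRing (MvPolynomial (Fin r) k)) (MvPolynomial.C c)) := by
          rw [hψK, ← MvPolynomial.algebraMap_eq, AlgHom.commutes]
        rw [hc]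
        exact Subalgebra.algebraMap_mem (Algebra.adjoin (FractionRing (MvPolynomial (Fin r) k)) (θ '' (t : Set A)))
          (algebraMap (MvPolynomial (Fin r) k) (FractionRing (MvPolynomial (Fin r) k)) (MvPolynomial.C c))
      · intro x y _ _ hx hy
        rw [map_add]; exact add_mem hx hy
      · intro x y _ _ hx hy
        rw [map_mul]; exact mul_mem hx hy
    · exact Algebra.adjoin_mono (Set.image_subset_range _ _)
  have hBfg : B.FG := by rw [hBt, ← Finset.coe_image]; exact Subalgebra.fg_adjoin_finset _
  haveI hBft : Algebra.FiniteType (FractionRing (MvPolynomial (Fin r) k)) B := B.fg_iff_finiteType.mp hBfg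
  -- Step 5: `𝔮 := 𝔪_L ∩ B` is maximal
  let 𝔮 : Ideal B := (maximalIdeal L).comap B.val.toRingHom
  haveI h𝔮p : 𝔮.IsPrime := Ideal.comap_isPrime _ _
  -- the residue field and the map `δ : A/𝔭 → κ`
  let res : L →+* ResidueField L := residue L
  have hresθ : ∀ a ∈ 𝔭, res (θ a) = 0 := by
    intro a ha
    rw [residue_eq_zero_iff]
    exact (IsLocalization.AtPrime.to_map_mem_maximal_iff L 𝔭 a).mpr ha
  let δ : A ⧸ 𝔭 →+* ResidueField L := Ideal.Quotient.lift 𝔭 (res.comp θ) hresθ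
  -- `κ` as an algebra over `k[X]` and over `K`, towers
  letI algκK : Algebra (FractionRing (MvPolynomial (Fin r) k)) (ResidueField L) := (res.comp ψK).toAlgebra
  letI algκP : Algebra (MvPolynomial (Fin r) k) (ResidueField L) :=
    ((res.comp ψK).comp (algebraMap (MvPolynomial (Fin r) k) (FractionRing (MvPolynomial (Fin r) k)))).toAlgebra
  haveI : IsScalarTower (MvPolynomial (Fin r) k) (FractionRing (MvPolynomial (Fin r) k)) (ResidueField L) :=
    IsScalarTower.of_algebraMap_eq (fun _ => rfl)
  have hδg : δ.comp g.toRingHom = algebraMap (MvPolynomial (Fin r) k) (ResidueField L) := by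
    have hR : ∀ P, algebraMap (MvPolynomial (Fin r) k) (ResidueField L) P = res (θ (φ P)) := fun P => by
      rw [RingHom.algebraMap_toAlgebra, RingHom.comp_apply, RingHom.comp_apply, hψK]
    refine MvPolynomial.ringHom_ext (fun c => ?_) (fun i => ?_)
    · rw [hR, ← MvPolynomial.algebraMap_eq, AlgHom.commutes, RingHom.comp_apply, AlgHom.toRingHom_eq_coe,
        AlgHom.coe_toRingHom, AlgHom.commutes, ← Ideal.Quotient.mk_algebraMap]
      show Ideal.Quotient.lift 𝔭 (res.comp θ) hresθ (Ideal.Quotient.mk 𝔭 _) = _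
      rw [Ideal.Quotient.lift_mk, RingHom.comp_apply]
    · rw [hR, RingHom.comp_apply, AlgHom.toRingHom_eq_coe, AlgHom.coe_toRingHom, ← hs i]
      show Ideal.Quotient.lift 𝔭 (res.comp θ) hresθ (Ideal.Quotient.mk 𝔭 _) = _
      rw [Ideal.Quotient.lift_mk, RingHom.comp_apply]
      simp [φ]
  -- every `δ ā` is integral over `K`
  have hint : ∀ ā : A ⧸ 𝔭, IsIntegral (FractionRing (MvPolynomial (Fin r) k)) (δ ā) := by
    intro ā
    obtain ⟨P, hPm, hP⟩ := hgint ā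
    have hPκ : IsIntegral (MvPolynomial (Fin r) k) (δ ā) := by
      refine ⟨P, hPm, ?_⟩
      rw [← hδg, ← Polynomial.hom_eval₂, hP, map_zero]
    exact hPκ.tower_top
  -- `ψ : B → κ`, its kernel is `𝔮`, its range is a field
  let ψ : B →ₐ[FractionRing (MvPolynomial (Fin r) k)] ResidueField L :=
    { toRingHom := res.comp B.val.toRingHom, commutes' := fun c => rfl }
  have hkerψ : RingHom.ker ψ.toRingHom = 𝔮 := by
    show RingHom.ker (res.comp B.val.toRingHom) = 𝔮
    rw [← RingHom.comap_ker, ker_residue]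
  have hψint : Algebra.IsIntegral (FractionRing (MvPolynomial (Fin r) k)) ψ.range := by
    constructor
    rintro ⟨y, b, rfl⟩
    rw [← isIntegral_algHom_iff ψ.range.val Subtype.val_injective]
    show IsIntegral _ (ψ b)
    -- `b ∈ K[θ A]`: induction on adjoin
    obtain ⟨b, hb⟩ := b
    refine Algebra.adjoin_induction (hx := hb) ?_ ?_ ?_ ?_
    · rintro _ ⟨a, rfl⟩
      have : ψ ⟨θ a, Algebra.subset_adjoin ⟨a, rfl⟩⟩ = δ (Ideal.Quotient.mk 𝔭 a) := by
        simp [ψ, δ]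
      rw [this]; exact hint _
    · intro c
      have hc : (⟨algebraMap _ L c, Subalgebra.algebraMap_mem B c⟩ : B) = algebraMap _ B c := Subtype.ext rfl
      rw [hc, AlgHom.commutes]; exact isIntegral_algebraMap
    · intro x y hx hy hix hiy
      have : ψ ⟨x + y, add_mem hx hy⟩ = ψ ⟨x, hx⟩ + ψ ⟨y, hy⟩ := by
        rw [← map_add]; rfl
      rw [this]; exact hix.add hiy
    · intro x y hx hy hix hiy
      have : ψ ⟨x * y, mul_mem hx hy⟩ = ψ ⟨x, hx⟩ * ψ ⟨y, hy⟩ := by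
        rw [← map_mul]; rfl
      rw [this]; exact hix.mul hiy
  have hfield : IsField ψ.range :=
    isField_of_isIntegral_of_isField' (Field.toIsField (FractionRing (MvPolynomial (Fin r) k)))
  haveI h𝔮max : 𝔮.IsMaximal := by
    have hsurj : Function.Surjective ψ.rangeRestrict := fun ⟨y, b, hb⟩ => ⟨b, Subtype.ext hb⟩
    have hker : RingHom.ker ψ.rangeRestrict.toRingHom = 𝔮 := by
      rw [← hkerψ]; ext b; simp [RingHom.mem_ker, Subtype.ext_iff]
    rw [← hker]
    exact Ideal.Quotient.maximal_of_isField _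
      (MulEquiv.isField hfield (RingHom.quotientKerEquivOfSurjective hsurj).toMulEquiv)
  -- Step 6: `L = B_𝔮`
  letI algBL : Algebra B L := B.val.toRingHom.toAlgebra
  have halg : ∀ b : B, algebraMap B L b = (b : L) := fun _ => rfl
  have hloc : IsLocalization.AtPrime L 𝔮 := by
    rw [IsLocalization.AtPrime, isLocalization_iff]
    refine ⟨?_, ?_, ?_⟩
    · rintro ⟨b, hb⟩
      rw [halg]
      have hb' : (b : L) ∉ maximalIdeal L := hb
      exact IsLocalRing.notMem_maximalIdeal.mp hb'
    · intro z
      obtain ⟨⟨a, u⟩, hz⟩ := IsLocalization.surj 𝔭.primeCompl z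
      have hu : θ u ∉ maximalIdeal L := fun h =>
        u.2 ((IsLocalization.AtPrime.to_map_mem_maximal_iff L 𝔭 u.1).mp h)
      exact ⟨⟨⟨θ a, Algebra.subset_adjoin ⟨a, rfl⟩⟩, ⟨⟨θ u, Algebra.subset_adjoin ⟨u.1, rfl⟩⟩, hu⟩⟩, hz⟩
    · intro x y hxy
      rw [halg, halg] at hxy
      exact ⟨1, by rw [Subtype.ext hxy]⟩
  exact ⟨r, B, inferInstance, inferInstance, inferInstance, hBft, 𝔮, h𝔮max, algBL, hloc, h0r⟩


/-- **The scheme lemma with the transcendence count**: as `NonClosedPointChart.exists_closedPoint_model`, plus `IsClosed {x} ∨ 0 < r`.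
[folklore; cite: EGAIV2, §6; GortzWedhorn2020, Thm. 5.22] -/
theorem exists_closedPoint_model_pos (p : ℕ) {k : Type} [Field k] [CharP k p] {X : Scheme.{0}} (f : X ⟶ Spec (.of k))
    [LocallyOfFiniteType f] [IsIntegral X] (x : X) :
    ∃ (r : ℕ) (Y : Scheme.{0}) (g : Y ⟶ Spec (.of (FractionRing (MvPolynomial (Fin r) k)))) (y : Y),
      IsAffine Y ∧ IsIntegral Y ∧ IsSeparated g ∧ LocallyOfFiniteType g ∧ QuasiCompact g ∧
      IsClosed ({y} : Set Y) ∧ Nonempty (X.presheaf.stalk x ≅ Y.presheaf.stalk y) ∧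
      topologicalKrullDim Y = ringKrullDim (X.presheaf.stalk x) ∧ (IsClosed ({x} : Set X) ∨ 0 < r) := by
  classical
  obtain ⟨_, ⟨U, hU, rfl⟩, hxU, -⟩ := X.isBasis_affineOpens.exists_subset_of_mem_open (Set.mem_univ x) isOpen_univ
  haveI : Nonempty (U : X.Opens) := ⟨⟨x, hxU⟩⟩
  have h1 : (f.appLE ⊤ U le_top).hom.FiniteType := f.finiteType_appLE (isAffineOpen_top _) hU le_top
  have h2 : (Scheme.ΓSpecIso (.of k)).inv.hom.FiniteType :=
    RingHom.FiniteType.of_surjective _ (Scheme.ΓSpecIso (.of k)).symm.commRingCatIsoToRingEquiv.surjective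
  letI : Algebra k Γ(X, U) := ((f.appLE ⊤ U le_top).hom.comp (Scheme.ΓSpecIso (.of k)).inv.hom).toAlgebra
  haveI : Algebra.FiniteType k Γ(X, U) := h1.comp h2
  letI := TopCat.Presheaf.algebra_section_stalk X.presheaf (⟨x, hxU⟩ : U)
  haveI : IsLocalization.AtPrime (X.presheaf.stalk x) (hU.primeIdealOf ⟨x, hxU⟩).asIdeal := hU.isLocalization_stalk ⟨x, hxU⟩
  obtain ⟨r, B, _, _, _, hBft, 𝔮, h𝔮, algBL, hloc, h0r⟩ :=
    exists_closedPoint_chart_ring_pos k Γ(X, U) (hU.primeIdealOf ⟨x, hxU⟩).asIdeal (X.presheaf.stalk x)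
  letI := algBL
  haveI := hloc
  haveI := h𝔮
  let y : Spec (.of B) := ⟨𝔮, h𝔮.isPrime⟩
  have hft : LocallyOfFiniteType (Spec.map (CommRingCat.ofHom (algebraMap (FractionRing (MvPolynomial (Fin r) k)) B))) :=
    HasRingHomProperty.Spec_iff.mpr (RingHom.finiteType_algebraMap.mpr hBft)
  let e : X.presheaf.stalk x ≅ (Spec (.of B)).presheaf.stalk y :=
    (IsLocalization.algEquiv 𝔮.primeCompl (X.presheaf.stalk x) (Localization.AtPrime 𝔮)).toRingEquiv.toCommRingCatIso ≪≫
      (Spec.stalkIso (.of B) y).symm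
  haveI : LocallyOfFiniteType (Spec.map (CommRingCat.ofHom (algebraMap (FractionRing (MvPolynomial (Fin r) k)) B))) := hft
  have hycl : IsClosed ({y} : Set (Spec (.of B))) := (PrimeSpectrum.isClosed_singleton_iff_isMaximal y).mpr h𝔮
  obtain ⟨d₀, hd₀⟩ := exists_topologicalKrullDim_le_of_locallyOfFiniteType
    (Spec.map (CommRingCat.ofHom (algebraMap (FractionRing (MvPolynomial (Fin r) k)) B)))
  obtain ⟨d, hd⟩ := exists_topologicalKrullDim_eq_nat hd₀
  have hdimy : ringKrullDim ((Spec (.of B)).presheaf.stalk y) = d :=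
    FTemkinClosedPoints.ringKrullDim_stalk_eq_of_isClosed
      (Spec.map (CommRingCat.ofHom (algebraMap (FractionRing (MvPolynomial (Fin r) k)) B))) hd y hycl
  have hdimx : ringKrullDim (X.presheaf.stalk x) = d := by
    rw [ringKrullDim_eq_of_ringEquiv e.commRingCatIsoToRingEquiv, hdimy]
  -- `x` closed if `𝔭_x` is maximal (Jacobson)
  have hxr : IsClosed ({x} : Set X) ∨ 0 < r := by
    rcases h0r with hmax | hr
    · left
      haveI : JacobsonSpace X := LocallyOfFiniteType.jacobsonSpace f
      have := isClosed_singleton_fromSpec_of_isMaximal hU (hU.primeIdealOf ⟨x, hxU⟩) hmax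
      rwa [IsAffineOpen.fromSpec_primeIdealOf] at this
    · exact Or.inr hr
  exact ⟨r, Spec (.of B), Spec.map (CommRingCat.ofHom (algebraMap _ B)), y, inferInstance, inferInstance, inferInstance,
    hft, inferInstance, hycl, ⟨e⟩, by rw [hd, hdimx], hxr⟩

/-! ## §2 The rung over purely transcendental ground fields -/

/-- [OURS · CANDIDATE statement] **`ClosedPointLocalResolutionAdmTr p e r` — LOCAL RESOLUTION AT CLOSED POINTS OF `e`-FOLDS OVER `k(X₁,…,X_r)`, Temkin's (iii)
category.** For every field `k` of characteristic `p`, with `K := FractionRing (MvPolynomial (Fin r) k)` (so `trdeg_k K = r` by construction; imperfect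
whenever `r ≥ 1`), every INTEGRAL separated finite-type `K`-scheme `Y` with `dim Y = e`, and every CLOSED point `y ∈ Y`: every ADMISSIBLE blowing up
`g : S′ → Spec 𝒪_{Y,y}` whose singular points all lie in the closed fibre admits a desingularization. Consumed only for prime `p`, `e ≥ 4`, `r ≥ 1`
(`localResolutionNonClosedGe4Adm_of_tr`); the level singled out by res-L1-w45a-plan-1 is `e = 4`, `r ≥ 1`. [candidate statement, OURS;
cite: Temkin2008, Prop. 2.3.4 (iii); Def. 2.2.6] -/
@[conjecture] def ClosedPointLocalResolutionAdmTr (p e r : ℕ) : Prop :=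
  ∀ (k : Type) [Field k] [CharP k p] (Y : Scheme.{0}) (g : Y ⟶ Spec (.of (FractionRing (MvPolynomial (Fin r) k)))),
    IsSeparated g → LocallyOfFiniteType g → QuasiCompact g → IsIntegral Y → topologicalKrullDim Y = e →
    ∀ y : Y, IsClosed ({y} : Set Y) →
      ∀ (S' : Scheme.{0}) (g' : S' ⟶ Spec (Y.presheaf.stalk y)) (I : (Spec (Y.presheaf.stalk y)).IdealSheafData),
        IsBlowup g' I → ((I.support : Set _) ⊆ (Scheme.regularLocus (Spec (Y.presheaf.stalk y)))ᶜ) →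
        (∀ s : S', s ∉ Scheme.regularLocus S' → g'.base s = closedPoint (Y.presheaf.stalk y)) →
        Scheme.AdmitsDesingularization S'

/-- **The all-fields rung implies the transcendental-field rung** (`k(X₁,…,X_r)` is a field of characteristic `p`). [plumbing] -/
theorem closedPointLocalResolutionAdmTr_of_adm {p e : ℕ} (h : ClosedPointLocalResolutionAdm.ClosedPointLocalResolutionAdm p e) (r : ℕ) :
    ClosedPointLocalResolutionAdmTr p e r := by
  intro k _ _ Y g hs hl hq hi hd y hy S' g' I hg' hI hfib
  haveI := NonClosedPointChart.charP_fractionRing_mvPolynomial p k r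
  exact h _ Y g hs hl hq hi hd y hy S' g' I hg' hI hfib

/-! ## §3 (LR_adm) from the transcendental-field rungs at levels `e ≥ 4`, `r ≥ 1` -/

/-- **The (LR_adm) body at a NON-CLOSED point `x` of local dimension `e`** from `ClosedPointLocalResolutionAdmTr p e r` for all `r ≥ 1`: `x` is a closed
point of an `e`-fold over `k(X₁,…,X_r)` with `r ≥ 1` (it is not closed) and the same local ring. [OURS · reduction; folklore] -/
theorem localBody_at_nonClosed_of_tr (p : ℕ) {k : Type} [Field k] [CharP k p] {X : Scheme.{0}} (f : X ⟶ Spec (.of k))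
    [LocallyOfFiniteType f] [IsIntegral X] (x : X) (hx : ¬ IsClosed ({x} : Set X)) {e : ℕ} (he : ringKrullDim (X.presheaf.stalk x) = e)
    (h : ∀ r : ℕ, 1 ≤ r → ClosedPointLocalResolutionAdmTr p e r) :
    ∀ (S' : Scheme.{0}) (g : S' ⟶ Spec (X.presheaf.stalk x)) (I : (Spec (X.presheaf.stalk x)).IdealSheafData),
      IsBlowup g I → ((I.support : Set _) ⊆ (Scheme.regularLocus (Spec (X.presheaf.stalk x)))ᶜ) →
      (∀ s : S', s ∉ Scheme.regularLocus S' → g.base s = closedPoint (X.presheaf.stalk x)) →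
      Scheme.AdmitsDesingularization S' := by
  obtain ⟨r, Y, gY, y, _, hint, hsep, hft, hqc, hycl, ⟨ε⟩, hdimY, hxr⟩ := exists_closedPoint_model_pos p f x
  have hr : 1 ≤ r := by
    rcases hxr with hcl | hr
    · exact absurd hcl hx
    · exact hr
  have hdimY' : topologicalKrullDim Y = e := by rw [hdimY, he]
  exact NonClosedPointChart.localBody_of_iso ε (h r hr k Y gY hsep hft hqc hint hdimY' y hycl)

/-- ★ **(LR_adm) ⟸ the transcendental-field rungs at all levels `e ≥ 4` and all `r ≥ 1`** — closed points over PERFECT ground fields are NOT consumed.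
[OURS · reduction; folklore] -/
theorem localResolutionNonClosedGe4Adm_of_tr
    (h : ∀ p e r : ℕ, p.Prime → 4 ≤ e → 1 ≤ r → ClosedPointLocalResolutionAdmTr p e r) :
    RegularOffFiniteOfLRAdm.LocalResolutionNonClosedGe4Adm := by
  intro p hp k _ _ X f _ hl _ _ x hx h4 S' g I hg hI hfib
  haveI := hl
  haveI : IsLocallyNoetherian X := LocallyOfFiniteType.isLocallyNoetherian f
  obtain ⟨n, hn⟩ := exists_nat_cast_eq_ringKrullDim (R := X.presheaf.stalk x)
  have h4n : 4 ≤ n := by rw [hn] at h4; exact_mod_cast h4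
  exact localBody_at_nonClosed_of_tr p f x hx hn (fun r hr => h p n r hp h4n hr) S' g I hg hI hfib

/-- **Per `d`-fold: only the levels `4 ≤ e ≤ d − 1` (and `r ≥ 1`) are consumed at its non-closed points.** [OURS · reduction; folklore] -/
theorem localBody_at_nonClosed_of_tr_lt (p : ℕ) {k : Type} [Field k] [CharP k p] {X : Scheme.{0}} (f : X ⟶ Spec (.of k))
    [LocallyOfFiniteType f] [IsIntegral X] {d : ℕ} (hd : topologicalKrullDim X = d)
    (h : ∀ e r : ℕ, 4 ≤ e → e + 1 ≤ d → 1 ≤ r → ClosedPointLocalResolutionAdmTr p e r)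
    (x : X) (hx : ¬ IsClosed ({x} : Set X)) (h4 : (4 : WithBot ℕ∞) ≤ ringKrullDim (X.presheaf.stalk x)) :
    ∀ (S' : Scheme.{0}) (g : S' ⟶ Spec (X.presheaf.stalk x)) (I : (Spec (X.presheaf.stalk x)).IdealSheafData),
      IsBlowup g I → ((I.support : Set _) ⊆ (Scheme.regularLocus (Spec (X.presheaf.stalk x)))ᶜ) →
      (∀ s : S', s ∉ Scheme.regularLocus S' → g.base s = closedPoint (X.presheaf.stalk x)) →
      Scheme.AdmitsDesingularization S' := by
  obtain ⟨e, he, hed⟩ := ClosedPointLocalResolutionAdm.ringKrullDim_stalk_add_one_le_of_not_isClosed f hd x hx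
  have h4e : 4 ≤ e := by rw [he] at h4; exact_mod_cast h4
  exact localBody_at_nonClosed_of_tr p f x hx he fun r hr => h e r h4e hed hr

end Summit.ResolutionOfSingularities.ResolutionOfSingularities.Theorems.FInjectiveMacaulayfication.ClosedPointLocalResolutionAdmTr

end
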